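import Literature.NumberTheory.Transcendental.GFunctionHassePrinciple
import HarnessLib

/-!
# André's Hasse principle at `K = ℚ`, degree `1`: rational linear relations among real
`G`-values at `ξ = 1/b` lift to functional relations (PROVED corollary)

`Literature/NumberTheory/Transcendental/GFunctionHassePrincipleRat.lean` — the MINIMAL FORM of
`Literature.NumberTheory.Transcendental.andre_hassePrinciple_gValues` used by route
`LiftingCriteria` of `KontsevichZagierPeriods` (crux `VertexLocalLift`,
`stmt-KontsevichZagierPeriods-3573`), PROVED from the named fact: for `G`-functions
`y₁, …, yₘ ∈ ℚ⟦X⟧` there is `b₀` such that for every integer `b ≥ b₀`, every rational linear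
relation `∑ⱼ λⱼ yⱼ(1/b) = 0` among the real values `yⱼ(1/b) = ∑ₖ aⱼₖ b⁻ᵏ` (as `tsum`s; genuine
sums once `1/b` is inside the discs of convergence, which holds for `b` large) is the
specialisation at `X = 1/b` of a `ℚ[X]`-linear functional relation `∑ⱼ Λⱼ(X) yⱼ(X) = 0` in
`ℚ⟦X⟧` with `Λⱼ(1/b) = λⱼ`.

Mechanism (as in the route thesis; [Andre1989] VII §5, [DawOrr2025] §2.3): for `ξ = 1/b`,
`b ≥ 2`, the only place `v` of `ℚ` with `|ξ|_v < 1` is the real one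
(`not_isSmallAt_finitePlace_inv_natCast`: `|1/b|_p = |b|_p⁻¹ ≥ 1`), so the single real
identity IS a global relation of degree `1` (`isGlobalRelationAt_linearForm_inv_natCast`), and
the Hasse principle bounds `h(1/b) = log b ≤ c₁(y)` unless the relation is trivial; so for
`b > exp c₁` it is trivial, and a homogeneous degree-`1` witness `Q̃ ∈ ℚ[X][Y]` is a linear form
`∑ Λⱼ(X) Yⱼ` (`eq_linearForm_of_isHomogeneous_one`).
-/

noncomputable section

open scoped Polynomial

namespace Literature.NumberTheory.Transcendental

namespace GFunction

/-! ### Linear forms `∑ⱼ cⱼ Yⱼ` as homogeneous polynomials of degree `1` -/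

section LinearForm

variable {R : Type*} [CommSemiring R] {m : ℕ}

/-- The linear form `∑ⱼ cⱼ Yⱼ ∈ R[Y₁,…,Yₘ]`. [folklore] -/
def linearForm (c : Fin m → R) : MvPolynomial (Fin m) R :=
  ∑ j, MvPolynomial.C (c j) * MvPolynomial.X j

/-- `∑ cⱼ Yⱼ` is homogeneous of degree `1`. [folklore] -/
theorem isHomogeneous_linearForm (c : Fin m → R) : (linearForm c).IsHomogeneous 1 :=
  MvPolynomial.IsHomogeneous.sum _ _ _ fun j _ => MvPolynomial.isHomogeneous_C_mul_X (c j) j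

/-- The coefficient of `Yⱼ` in `∑ cᵢ Yᵢ` is `cⱼ`. [folklore] -/
theorem coeff_single_linearForm (c : Fin m → R) (j : Fin m) :
    MvPolynomial.coeff (Finsupp.single j 1) (linearForm c) = c j := by
  classical
  simp only [linearForm, MvPolynomial.coeff_sum, MvPolynomial.coeff_C_mul, MvPolynomial.coeff_X,
    Finsupp.single_left_inj (one_ne_zero' ℕ), mul_ite, mul_one, mul_zero]
  simp

/-- Evaluating `∑ cⱼ Yⱼ` in an `R`-algebra. [folklore] -/
theorem aeval_linearForm {A : Type*} [CommSemiring A] [Algebra R A] (c : Fin m → R)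
    (y : Fin m → A) : MvPolynomial.aeval y (linearForm c) = ∑ j, algebraMap R A (c j) * y j := by
  simp [linearForm, map_sum]

/-- Evaluating `∑ cⱼ Yⱼ` at a point of `Rᵐ`. [folklore] -/
theorem eval_linearForm (c : Fin m → R) (g : Fin m → R) :
    MvPolynomial.eval g (linearForm c) = ∑ j, c j * g j := by
  simp [linearForm, map_sum]

/-- Mapping the coefficients of `∑ cⱼ Yⱼ`. [folklore] -/
theorem map_linearForm {S : Type*} [CommSemiring S] (f : R →+* S) (c : Fin m → R) :
    MvPolynomial.map f (linearForm c) = linearForm fun j => f (c j) := by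
  simp [linearForm, map_sum]

/-- A homogeneous polynomial of degree `1` is the linear form of its degree-one coefficients.
[folklore] -/
theorem eq_linearForm_of_isHomogeneous_one {Q : MvPolynomial (Fin m) R} (hQ : Q.IsHomogeneous 1) :
    Q = linearForm fun j => MvPolynomial.coeff (Finsupp.single j 1) Q := by
  classical
  ext d
  by_cases hd : d.degree = 1
  · obtain ⟨a, rfl⟩ : d ∈ Set.range fun a : Fin m => Finsupp.single a 1 := by
      rw [Finsupp.range_single_one]; exact hd
    rw [coeff_single_linearForm]
  · rw [hQ.coeff_eq_zero hd]
    simp only [linearForm, MvPolynomial.coeff_sum, MvPolynomial.coeff_C_mul, MvPolynomial.coeff_X]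
    symm
    refine Finset.sum_eq_zero fun j _ => ?_
    rw [if_neg, mul_zero]
    rintro rfl
    exact hd (Finsupp.degree_single _ _)

end LinearForm

/-! ### At `ξ = 1/b` only the real place of `ℚ` is small -/

open IsDedekindDomain NumberField NumberField.HeightOneSpectrum in
/-- For `b ∈ ℕ`, `b ≠ 0`, and a finite place `v` of `ℚ`, `|1/b|_v = |b|_v⁻¹ ≥ 1`: the smallness
condition `|ξ|_v < min{1, R_v}` FAILS at every finite place, so finite places impose nothing on a
global relation at `ξ = 1/b`. [folklore] -/
theorem not_isSmallAt_finitePlace_inv_natCast (b : ℕ) (hb : b ≠ 0) {n : ℕ}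
    (y : Fin n → PowerSeries ℚ) (v : HeightOneSpectrum (𝓞 ℚ)) :
    ¬ IsSmallAt (FinitePlace.embedding v) y ((b : ℚ)⁻¹) := by
  apply not_isSmallAt_of_one_le_norm
  rw [map_inv₀, norm_inv, FinitePlace.norm_embedding]
  have h1 : adicAbv ℚ v (b : ℚ) ≤ 1 := adicAbv_natCast_le_one ℚ v b
  have h0 : 0 < adicAbv ℚ v (b : ℚ) := by
    rw [AbsoluteValue.pos_iff]; exact_mod_cast hb
  exact one_le_inv_iff₀.mpr ⟨h0, h1⟩

/-- Along any `σ : ℚ →+* ℂ` (the unique complex embedding), the `σ`-adic value of `y ∈ ℚ⟦X⟧` at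
`ξ` is the complex series `∑ₖ aₖ ξᵏ`. [folklore] -/
theorem adicValue_rat (σ : ℚ →+* ℂ) (y : PowerSeries ℚ) (ξ : ℚ) :
    adicValue σ y ξ = ∑' k : ℕ, ((PowerSeries.coeff k y : ℚ) : ℂ) * (ξ : ℂ) ^ k := by
  simp [adicValue, eq_ratCast]

/-- A real linear identity `∑ⱼ λⱼ (∑ₖ aⱼₖ ξᵏ) = 0` among the real values of `y₁,…,yₘ ∈ ℚ⟦X⟧` at
`ξ = 1/b` (`b ≠ 0`) is a GLOBAL relation of degree `1` in André's sense: the real place is the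
only candidate small place. [folklore] -/
theorem isGlobalRelationAt_linearForm_inv_natCast {m : ℕ} (y : Fin m → PowerSeries ℚ) (b : ℕ)
    (hb : b ≠ 0) (c : Fin m → ℚ)
    (hrel : ∑ j, (c j : ℝ) * (∑' k : ℕ, ((PowerSeries.coeff k (y j) : ℚ) : ℝ) * ((b : ℝ)⁻¹) ^ k)
      = 0) :
    IsGlobalRelationAt y ((b : ℚ)⁻¹) (linearForm c) := by
  refine ⟨fun σ hs => ⟨hs, ?_⟩, fun v hs => absurd hs (not_isSmallAt_finitePlace_inv_natCast b hb y v)⟩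
  -- the complex (= real) identity
  have hC : ∑ j, (c j : ℂ) * (∑' k : ℕ, ((PowerSeries.coeff k (y j) : ℚ) : ℂ) * ((b : ℂ)⁻¹) ^ k)
      = 0 := by
    have := congrArg (fun x : ℝ => (x : ℂ)) hrel
    simp only [Complex.ofReal_sum, Complex.ofReal_mul, Complex.ofReal_ratCast, Complex.ofReal_zero,
      Complex.ofReal_tsum, Complex.ofReal_pow, Complex.ofReal_inv, Complex.ofReal_natCast] at this
    exact this
  simp only [adicEval, map_linearForm, eval_linearForm, adicValue_rat, eq_ratCast]
  push_cast at hC ⊢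
  exact hC

end GFunction

/-! ### The corollary at `K = ℚ`, `δ = 1`, `ξ = 1/b` -/

open GFunction in
/-- **André's Hasse principle for `G`-values at `K = ℚ`, degree `1`, `ξ = 1/b`** (the form used
by crux `VertexLocalLift`; PROVED from the named fact `andre_hassePrinciple_gValues`): let
`y₁, …, yₘ ∈ ℚ⟦X⟧` be `G`-functions, `yⱼ = ∑ₖ aⱼₖ Xᵏ`. There is `b₀` such that for every integer
`b ≥ b₀` and every `λ ∈ ℚᵐ`, if the real numbers `yⱼ(1/b) := ∑ₖ aⱼₖ b⁻ᵏ` satisfy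
`∑ⱼ λⱼ yⱼ(1/b) = 0`, then there are `Λⱼ ∈ ℚ[X]` with `Λⱼ(1/b) = λⱼ` and `∑ⱼ Λⱼ yⱼ = 0` in
`ℚ⟦X⟧` — the numerical relation is the specialisation at `1/b` of a functional one. (At `ξ = 1/b`
the real place is the only place of `ℚ` with `|ξ|_v < 1`, so the real identity is a GLOBAL
relation of degree `1`; non-triviality would force `log b = h(1/b) ≤ c₁(y)`; take
`b₀ = ⌊exp c₁⌋ + 2`. No radius hypothesis is needed: where `1/b` is outside a disc of convergence
the relation is vacuously global, as in the printed theorem, and for `b` large `1/b` is inside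
every disc anyway; the values are the `tsum`s, genuine sums inside the discs.)
[cite: DawOrr2025, Theorem 2.5] -/
theorem andre_hassePrinciple_rat_linear (h : andre_hassePrinciple_gValues) {m : ℕ}
    (y : Fin m → PowerSeries ℚ) (hy : ∀ j, IsGFunction (y j)) :
    ∃ b₀ : ℕ, ∀ b : ℕ, b₀ ≤ b → ∀ c : Fin m → ℚ,
      ∑ j, (c j : ℝ) * (∑' k : ℕ, ((PowerSeries.coeff k (y j) : ℚ) : ℝ) * ((b : ℝ)⁻¹) ^ k) = 0 →
        ∃ Λ : Fin m → ℚ[X], (∀ j, (Λ j).eval ((b : ℚ)⁻¹) = c j) ∧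
          ∑ j, (Λ j : PowerSeries ℚ) * y j = 0 := by
  obtain ⟨c₁, c₂, -, -, H⟩ := h ℚ m y hy
  refine ⟨⌊Real.exp c₁⌋₊ + 2, fun b hb c hrel => ?_⟩
  have hb0 : b ≠ 0 := by omega
  have hexp : Real.exp c₁ < b :=
    calc Real.exp c₁ < ⌊Real.exp c₁⌋₊ + 1 := Nat.lt_floor_add_one _
      _ ≤ (b : ℝ) := by exact_mod_cast (by omega : ⌊Real.exp c₁⌋₊ + 1 ≤ b)
  -- the data of the fact at `K = L = ℚ`
  have hξ : ((b : ℚ)⁻¹) ≠ 0 := inv_ne_zero (by exact_mod_cast hb0)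
  have hmap : (fun j => PowerSeries.map (algebraMap ℚ ℚ) (y j)) = y := by
    funext j; simp
  have hglob : IsGlobalRelationAt y ((b : ℚ)⁻¹) (linearForm c) :=
    isGlobalRelationAt_linearForm_inv_natCast y b hb0 c hrel
  -- triviality, by the height bound `log b ≤ c₁`
  have htriv : IsTrivialRelationAt y ((b : ℚ)⁻¹) (linearForm c) 1 := by
    by_contra hnt
    have hH := H ℚ ((b : ℚ)⁻¹) hξ 1 one_pos (linearForm c) (isHomogeneous_linearForm c)
      (by rw [hmap]; exact hglob) (by rw [hmap]; exact hnt)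
    have hheight : Height.logHeight₁ ((b : ℚ)⁻¹) = Real.log b := by
      haveI : NeZero b := ⟨hb0⟩
      rw [Height.logHeight₁_inv, Rat.logHeight₁_natCast]
    rw [hheight, Module.finrank_self] at hH
    simp only [Nat.cast_one, one_mul, Real.one_rpow, mul_one] at hH
    have : c₁ < Real.log b := by
      rw [← Real.log_exp c₁]
      exact Real.log_lt_log (Real.exp_pos _) hexp
    linarith
  -- unpack the degree-one witness `Q̃ = ∑ Λⱼ(X) Yⱼ`
  obtain ⟨Qt, hQt, haeval, hspec⟩ := htriv
  refine ⟨fun j => MvPolynomial.coeff (Finsupp.single j 1) Qt, fun j => ?_, ?_⟩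
  · have := congrArg (MvPolynomial.coeff (Finsupp.single j 1)) hspec
    rw [MvPolynomial.coeff_map, coeff_single_linearForm] at this
    simpa using this
  · rw [eq_linearForm_of_isHomogeneous_one hQt, aeval_linearForm] at haeval
    simpa [PowerSeries.algebraMap_apply'] using haeval

end Literature.NumberTheory.Transcendental
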